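import Summits.BirchSwinnertonDyer.Rank1Residual.X2.CongruenceTransferCoveredCongruence
import Summits.BirchSwinnertonDyer.Rank1Residual.X2.RankOneNonsplitCertificate
import HarnessLib

/-!
# Class X2c, NON-SPLIT ∧ ¬GVPar sub-cell (O9 `CellCNonsplitNotGV`): route G with a COVERED relative at
# RANK ONE with the `L`-function certificate — `hna'` AND the height certificate discharged
# (cell `b2b-bsdres`, unit `b2b-bsdres-eisenstein-p2`, gen 19; companion of cc-typer-6's
# `X2/CongruenceTransferRankOne.lean` and of `X2/RankOneNonsplitCertificate.lean`)

HONEST FRAMING (run/shared/lean/b2b/bsd-rank1-residual/, verbatim in every file): the goal of the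
cell is to DELETE the COMBINATION-SHAPED residual classes of the Birch–Swinnerton-Dyer formula for
ALL analytic-rank `≤ 1` elliptic curves over `ℚ` — "full BSD formula for every rank `≤ 1` curve in
class `C`" assembled STRICTLY from published theorems — so that the rank-`≤ 1` remainder becomes
exactly the CONSTRUCTION-SHAPED classes, which are TYPED (missing-input `Prop`s), NOT attempted.
This is not "finishing BSD". Research route; NO CLAIM BEYOND STATED CLASSES; nothing here changes
a label; X2c stays CONSTRUCTION-SHAPED (certificate-shaped on this sub-cell: per pair two `(μ, λ)`
certificates, a torsion isomorphism with a covered relative, and ONE `L`-function certificate).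
Theorems only: no definition, no named fact.

WHAT. cc-typer-6's `bsdp_of_coveredRelative_rankOne_of_not_split` closes a non-split X2c pair from a
covered good relative (CGS 2025 Thm. A) with two per-pair binders beyond the census certificates:
the relative's non-anomaly `hna'` and the HEIGHT certificate `hSch`. Gen 15 discharged `hna'`
(`mazurMainConjectureAt_of_coveredRelative_nonsplit`: a good relative of a non-split pair is
non-anomalous by the congruence); gen 19 turned `hSch` into the `L`-function statement
`ord_{T=0} L_p(E₀,T) = 1` under the transported main conjecture
(`bsdp_of_cellC_of_not_split_of_mazurMainConjectureAt_of_orderOne`). Composition: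

* **`bsdp_of_coveredRelative_rankOne_nonsplit_of_orderOne`** — NON-split X2c pair `(E₀, p)` +
  covered relative `E'` (`E'[p] ≅ E₀[p]`, good at `p`) + the `(μ_an, λ_an)` certificates of both +
  `ord_{T=0} L_p(E₀, T) = 1` ⟹ `BSD(E₀, p)`. No `hna'`, no height, no GV parity.
* Degenerate case (no new declaration): when the pair itself is λ-minimal the relative is not
  needed at all — `bsdp_of_cellC_of_not_split_of_lamMin` (gen 19, `RankOneNonsplitCertificate`).

References: [CastellaGrossiSkinner2025] Thm. A; [GreenbergVatsal2000] Thm. (1.4), §1 (5)–(7), §2;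
[Wuthrich2014] Thm. 16; [Disegni2020] Thm. 4; [SteinWuthrich2013] Thm. 6.1, §4.2;
HOME/b2b-bsdres-eisenstein-p2/X2-GAP.md §24; HOME/class-closure/O9/ (T-ROUTEG answer).
-/

set_option autoImplicit false

noncomputable section

open scoped Classical MatrixGroups ModularForm

open PowerSeries CongruenceSubgroup WeierstrassCurve NumberField IsDedekindDomain
  Literature.NumberTheory.EllipticCurves
  Literature.NumberTheory.EllipticCurves.ModularForms
  Literature.NumberTheory.EllipticCurves.Rank1Residual
  Literature.NumberTheory.EllipticCurves.Rank1Residual.Typed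
  Literature.NumberTheory.EllipticCurves.Wuthrich2014
  Literature.NumberTheory.EllipticCurves.SteinWuthrich2013
  Literature.NumberTheory.EllipticCurves.Greenberg1999
  Literature.NumberTheory.EllipticCurves.GreenbergVatsal2000
  Literature.NumberTheory.EllipticCurves.CastellaGrossiSkinner2025
  Literature.NumberTheory.EllipticCurves.Disegni2020
  Summit.BirchSwinnertonDyer.BirchSwinnertonDyer.Theorems.Rank1ResidualX1Defs
  Summit.BirchSwinnertonDyer.Rank1Residual.X1.MuLambda
  Summit.BirchSwinnertonDyer.Rank1Residual.X1.MuPart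
  Summit.BirchSwinnertonDyer.Rank1Residual.X1.ParitySqueeze
  Summit.BirchSwinnertonDyer.Rank1Residual.X1.TamagawaSqueeze
  Summit.BirchSwinnertonDyer.Rank1Residual.X1.CongruenceTransfer
  Summit.BirchSwinnertonDyer.Rank1Residual.X2.CongruentLambdaShiftMultiplicative
  Summit.BirchSwinnertonDyer.Rank1Residual.X2.CongruentPartnerAnomalous

namespace Summit.BirchSwinnertonDyer.Rank1Residual.X2

variable {W W' : WeierstrassCurve ℚ} [W.IsElliptic] [W.IsGloballyMinimal]
  [W'.IsElliptic] [W'.IsGloballyMinimal] {p : ℕ} [Fact p.Prime]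
  (S₀ : Finset (HeightOneSpectrum (𝓞 ℚ)))

/-- **NON-SPLIT X2c pair, COVERED relative, `L`-function certificate ⟹ `BSD(E₀, p)`.** Data per
pair: the target's `(μ_an, λ_an) = (0, n)` at the multiplicative prime (`hμ0`, `hlam`), a good
relative `E'` with `E'[p] ≅ E₀[p]` (`hiso`) and its `(μ_an, λ_an) = (0, n')` (`hμ0'`, `hlam'`), the
bad-prime set `S₀` with the `δ`-shift bookkeeping (`hk`, `hn`), and `ord_{T=0} L_p(E₀,T) = 1` for THE
non-split Mazur–Tate–Teitelbaum function (`hordL`). Class-level inputs: CGS 2025 Thm. A (`hA`),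
Wuthrich 2014 Thm. 16 / Kato (`hWu`, `hW16`), GV §§1–2 at `p ‖ N` and at good `p` (`hAm`, `hBm`, `hF`,
`hGV`, `hA7`, `hB`), Tate uniformisation (`hT`, `hT'`), Disegni 2020 Thm. 4 (`hDis`), Stein–Wuthrich
Thm. 6.1 + §4.2 (`hJn`, `hHn`), Gross–Zagier (`hGZ`), GZK, modularity (`hpar`). The relative's
non-anomaly is READ OFF the congruence (gen 15) and Schneider's non-degeneracy off `hordL` (gen 19).
[cite: CastellaGrossiSkinner2025, Theorem A]
[cite: GreenbergVatsal2000, Thm. (1.4), §1 (5)–(7), pp. 14–15, §2 pp. 20–27]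
[cite: Wuthrich2014, Thm. 16 (p. 397)] [cite: Disegni2020, Thm. 4 (§3.2)]
[cite: SteinWuthrich2013, Thm. 6.1 (p. 20), §3.1 (p. 9), §4.2] -/
theorem bsdp_of_coveredRelative_rankOne_nonsplit_of_orderOne (hA : thmA_charIdeal_eq_padicLFunction)
    (hWu : thm16_charIdeal_dvd_multiplicative_of_reducible)
    (hW16 : Wuthrich2014.charIdeal_dvd_padicLFunction)
    (hDis : padicBSD_rankOne_nonsplitMult) (hJn : thm61_nonsplitMultiplicative)
    (hHn : exists_isMultCanonical) (hGZ : GrossZagier1986_thm_I_7_3)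
    (hGZK : rank_eq_analyticRank_of_analyticRank_le_one)
    (hpar : nonempty_modularParametrizationData)
    (hT : Silverman1994_thmV53_corV54_tateUniformisation.{0})
    (hT' : Silverman1994_thmV53_tateUniformisation.{0})
    (hAm : lambda_nonPrimitive_eq_add_sum_delta_multiplicative)
    (hBm : datumSelmer_divisible_of_finite_torsionBy) (hF : datumStrictSelmer_lt_datumSelmer_of_split)
    (hGV : imKummer_ge_greenbergCondition_at_p) (hA7 : lambda_nonPrimitive_eq_add_sum_delta)
    (hB : divisible_nonPrimitiveSelmerInfty_of_mu_eq_zero)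
    (hc : CellC W p) (hns : ¬ W.HasSplitMultiplicativeReductionAtPrime p) {n : ℕ}
    (hμ0 : AnalyticMuLE W p 0) (hlam : AnalyticLambdaEq W p n)
    (hgood' : W'.HasGoodReductionAtPrime p) {n' : ℕ}
    (hμ0' : X1.MuPart.AnalyticMuLE W' p 0) (hlam' : X1.ParitySqueeze.AnalyticLambdaEq W' p n')
    (hS₀ : ∀ v ∈ S₀, ((p : ℕ) : 𝓞 ℚ) ∉ v.asIdeal)
    (hS : ∀ v : HeightOneSpectrum (𝓞 ℚ), v ∉ S₀ → ((p : ℕ) : 𝓞 ℚ) ∉ v.asIdeal →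
      W.HasGoodReductionAt v)
    (hS' : ∀ v : HeightOneSpectrum (𝓞 ℚ), v ∉ S₀ → ((p : ℕ) : 𝓞 ℚ) ∉ v.asIdeal →
      W'.HasGoodReductionAt v)
    (hiso : TorsionIso W W' p) {k : ℕ}
    (hk : (k : ℤ) = n' + ∑ v ∈ S₀, ((delta W' p v : ℤ) - (delta W p v : ℤ))) (hn : n ≤ k)
    (hordL : ∀ {N : ℕ} [NeZero N] (f : CuspForm (Gamma0 N) 2), IsNewformOf W f →
      ∀ (ϖ : ℚ), (ϖ : ℝ) * W.realPeriodRat = plusPeriod f →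
      ∀ L : PowerSeries ℚ_[p], IsMultPAdicLFunctionOf f p (-1) L → L.order = ((1 : ℕ) : ℕ∞)) :
    BSDp W p :=
  bsdp_of_cellC_of_not_split_of_mazurMainConjectureAt_of_orderOne W p hDis hJn hHn hGZ hGZK hpar hc hns
    (mazurMainConjectureAt_of_coveredRelative_nonsplit S₀ hA hWu hW16 hpar hT hT' hAm hBm hF hGV hA7 hB
      hc.2.1 hc.2.2.2 hns hc.2.2.1 hμ0 hlam hgood' hμ0' hlam' hS₀ hS hS' hiso hk hn)
    hordL

end Summit.BirchSwinnertonDyer.Rank1Residual.X2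

end
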